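import Summits.QuantumFields.BalabanUV.Beta.D1BFx.LandauResolventSuperpositionRight
import Summits.QuantumFields.BalabanUV.Beta.D1BFx.CoarseLegJunction
import Summits.QuantumFields.BalabanUV.Beta.D1BFx.PeriodicArrays

/-!
# `BalabanUV.Beta.D1BFx.CoarseGramInverse` — road «BF-x» for binder row D1, slot (K), `K-ASSEMBLY-SPEC.md` brick TB2 (N-side), part 3b:
# **THE COARSE GRAM `𝒬·Ga·𝒬ᵀ` OF THE GLUON LEG AND ITS INVERSE, AS KERNELS ON `ℤ⁴` AND ON EVERY COARSE TORUS** —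
# X₁b in KERNEL form (`compF (toF (𝒬Ga𝒬ᵀ)) (toF Cun′) = δ`, `Cun′ := c⁻¹·(a′·δ + wΦ)`), Lemma 2.2.2 on the coarse torus `Site 4 p`
# (`(𝒬Ga𝒬ᵀ)^·Cun′^ = 1 = Cun′^·(𝒬Ga𝒬ᵀ)^`), and at the road's legs: **THE TYPED COARSE LEG `CoarseLeg.Cun (m+1) a` INVERTS THE COARSE GRAM OF
# `Ga (m+1) a` UP TO `(m+1)⁸`** (typer object T3's identification, LEAVES-BFx row T3 / K-R1-SPEC v2 §4 X₁(b)), modulo the displayed `Spr (Ga (m+1) a)`.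

HONEST FRAMING (cell contract, verbatim): «discharging `BetaPertH` makes Bałaban's UV stability UNCONDITIONAL — a real constructive-QFT
result; it is NOT the continuum limit and NOT the Clay problem.»  HONEST DEPENDENCY (verbatim): «continuum YM on T⁴ ⇐ BetaPertH ∧ nine
spine estimates (0/9 proved); BetaPertH ⇐ (D1) ∧ (D4) ∧ CAP+tail; G-an2-4 gates asym, D1 and NE2/3/4.»  THIS MODULE DISCHARGES NOTHING of
D1 / BetaPertH: [folklore] bookkeeping BY NAME over ne9-leaf-06-g28's `LandauResolventSuperpositionRight` (`X1b_right_of_X1a`,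
`T_apply_eq_tsum`, `T_apply_shiftedMultiplier`, `summable_Tcol_mul`, `Tcol_eq`, `Tcol_symm`, `spr_shiftedMultiplier`, `kerOp₁_smul`), this
lineage's `LandauDictionaryInstance.hX1a_Ga` (X₁a, PROVED) and `CoarseLegJunction.Cun_eq_wΦ`, leaf-03-g7's `FibredPeriodisation` (`compF`,
`periodiseF`, `lemma222F`), gan24-leaf-06-g29's `PeriodicArrays.toF`, an4's `EntrywiseVolumeLimit` (`IsPeriodic₂`, `RowBound`, `Decay₂`) and
this lineage's `GluonLeg` (`Ga_symm`, `shiftK_Ga`).  Two [our object] data `def`s with bodies (`gramM`, `multM`); no `def … : Prop`; nothing is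
cited; 0 sorry.  The decay of `Ga` is a DISPLAYED hypothesis (`Decays Ga C δ` / `Spr (Ga (m+1) a)` — at the road's legs it is the printed
[B5, Prop. 1.2] ∧ [B5, (1.126)–(1.127)] content, `GluonLegTails.spr_Ga_of_prop12`); nothing else is assumed.  NOT summit progress; NOT BetaPertH,
NOT continuum, NOT Clay.

ABSOLUTE RULE (cell, verbatim): «No internally-minted statement may enter as a cited fact. Every hypothesis is either kernel-proved in this
package or a verbatim quotation of a PUBLISHED theorem with page reference. The manuscript(s) under audit are NOT citable for their own
disputed steps — they are the thing under adjudication; programme-internal (2001/route/tribunal) claims are never citable.»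

WHY (`HOME/b2b-balaban-beta-d1-p2/K-ASSEMBLY-SPEC.md` v1.1 §1 TB2 «N-SIDE ON THE TORUS», part 3b).  On every coarse torus the R-weighted
bordered system `N_T = kkt (K̂₀ + P̂₀ᵀP̂₀) Q̂₀` of the slice-transfer identity is inverted by finite Woodbury (`BorderedInverseMassive.kkt_inv_eq_massiveBlocks`)
from the torus massive propagator `Ĝ` (`VectorPropagatorImages`: the periodised `Ga`) AND the inverse `Ĉ` of the COARSE GRAM `Q̂·Ĝ·Q̂ᵀ`.  This file
supplies `Ĉ`: the coarse Gram is the periodisation of the `ℤ⁴` kernel `gramM n Ga = 𝒬Ga𝒬ᵀ` (columns = X₁b's `Φ̃`), and X₁b — PROVED for the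
road's legs up to the printed decay — says in kernel form that the shifted constraint multiplier `Cun′ = c⁻¹(a′δ + wΦ)` (= `(m+1)⁻⁸·Cun (m+1) a` at the
road's constants `(r, a′, c) = (2, 2a/(m+1)⁸, 2)`) is its two-sided inverse; an4's Lemma 2.2.2 moves this to every coarse torus.  Both kernels are
translation invariant with uniform row bounds, so TA1's product rules and TA3's trace limits apply to them downstream (part 3c: `N_T⁻¹`).

CONTENT (block side `n ≥ 1`; a fine leg `Ga : MKer 4 (Fin 4)`; all [folklore] / [our object]).  §1 `gramM n Ga`, `multM n a′ c`; `gramM_eq_legSum`,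
`gramM_symm`, **`gramM_translate`** (⟸ `shiftK (n•t) Ga = Ga`), `multM_translate`, `multM_road_eq_Cun` (`multM (m+1) (2a/(m+1)⁸) 2 = (m+1)⁻⁸·Cun (m+1) a`).
§2 **`compF_gramM_multM`**: `compF (toF (gramM n Ga)) (toF (multM n a′ c)) = kdeltaF` ⟸ X₁a-display ∧ `Decays Ga` ∧ `Ga` symmetric ∧ `c ≠ 0`.
§3 `summable_abs_row_gramM`, `isPeriodic₂_gramM` / `isPeriodic₂_multM` (every period), `exists_rowBound_multM`, `exists_rowBound_gramM`.
§4 **`gram_torus_inverse`** (`(gramM)^·(multM)^ = 1 ∧ (multM)^·(gramM)^ = 1` on every coarse torus `Site 4 p`), `isUnit_det_gram_torus`, `gram_torus_inv_eq`,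
`eq_multM_hat_of_mul_eq_one(')` (ANY torus one-sided inverse of the coarse Gram is `(multM)^`).  §5 AT THE ROAD'S LEGS (modulo `Spr (Ga (m+1) a)` only):
`compF_gram_Cun_Ga` (`compF (toF (𝒬Ga𝒬ᵀ)) (toF (Cun (m+1) a)) = (m+1)⁸•δ`), **`gram_torus_inverse_Ga`**, `isUnit_det_gram_torus_Ga`, `gram_torus_inv_eq_Ga`
(`((𝒬Ga𝒬ᵀ)^)⁻¹ = ((m+1)⁻⁸·Cun (m+1) a)^`), `isPeriodic₂_gramM_Ga`, `exists_rowBound_gramM_Ga`.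
Unit `b2b-balaban-beta-d1-p2` (road owner, gen 6).
-/

noncomputable section

namespace Summit.QuantumFields.BalabanUV.Beta.D1BFx.CoarseGramInverse

open Finset
open scoped BigOperators
open Literature.MathematicalPhysics.QuantumFieldTheory.Balaban1983to89
open Literature.MathematicalPhysics.QuantumFieldTheory.Balaban1983to89.Beta
open ExpKernelCalculus (MKer Decays shiftK)
open AffineAveraging (Form1 unitVec toSite dz curv curvAdj codiff₁ contourSum)
open AffineReproduction (contourSumAdj)
open KKTFluctuationKernel (delta1)
open KernelSpecInstance (wΦ contourSum_smul contourSumAdj_smul)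
open KKTFluctuationUnique (abs_le_of_decay510)
open B12Sec2to5 (l1)
open OneStepResolventKernel (Fib)
open OneStepKernelFamily (legPt LegIdx)
open StepDriftWitness (legPt_inl_eq)
open Summit.QuantumFields.BalabanUV.Beta.TameKernelCalculus (Spr)
open Summit.QuantumFields.BalabanUV.Beta.D1BFx.KernelFormOperators (kerOp₁ Rf)
open Summit.QuantumFields.BalabanUV.Beta.D1BFx.LandauResolventSuperposition (unitSrc)
open Summit.QuantumFields.BalabanUV.Beta.D1BFx.LandauResolventSuperpositionRight (Tcol_eq Tcol_symm X1b_right_of_X1a summable_Tcol_mul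
  T_apply_eq_tsum T_apply_shiftedMultiplier spr_shiftedMultiplier kerOp₁_smul)
open Summit.QuantumFields.BalabanUV.Beta.D1BFx.FibredPeriodisation (FKer Kfib Kfib_apply kdeltaF compF periodiseF lemma222F
  eq_periodiseF_of_mul_eq_one eq_periodiseF_of_mul_eq_one')
open Summit.QuantumFields.BalabanUV.Beta.D1BFx.PeriodicArrays (toF)
open Summit.QuantumFields.BalabanUV.Beta.D1BFx.CoarseLeg (Cun)
open Summit.QuantumFields.BalabanUV.Beta.D1BFx.CoarseLegJunction (Cun_eq_wΦ)
open Summit.QuantumFields.BalabanUV.Beta.D1BFx.GluonLeg (Ga Ga_symm shiftK_Ga)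

variable (n : ℕ) [NeZero n]

/-! ## §1 The objects: the coarse Gram of a fine leg and the shifted constraint multiplier -/

/-- [our object] **THE COARSE GRAM `T := 𝒬·Ga·𝒬ᵀ`** of a fine leg `Ga` at block side `n`, as a kernel on the bonds of the unit lattice:
`gramM n Ga y y′ κ l := (𝒬 (Ga (𝒬ᵀ e_{(l,y′)}))) κ y` — the column of X₁b's `Φ̃` at the coarse bond `(l, y′)` read at `(κ, y)`. -/
def gramM (Ga : MKer 4 (Fin 4)) : MKer 4 (Fin 4) :=
  fun y y' κ l => contourSum n (kerOp₁ Ga (contourSumAdj n (unitSrc l y'))) κ y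

/-- [our object] **THE SHIFTED CONSTRAINT MULTIPLIER** `Cun′ := c⁻¹·(a′·δ + wΦ)` as a kernel on the bonds of the unit lattice:
`multM n a′ c y′ y₀ m l := c⁻¹·(a′·[y′ = y₀ ∧ m = l] + wΦ m l (y′ − y₀))` (verbatim the kernel of `LandauResolventSuperpositionRight.spr_shiftedMultiplier`). -/
def multM (a' c : ℝ) : MKer 4 (Fin 4) :=
  fun y' y₀ m l => c⁻¹ * (a' * (if y' = y₀ ∧ m = l then (1 : ℝ) else 0) + wΦ (N := n) m l (y' - y₀))

omit [NeZero n] in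
/-- [our object] Unfolding `gramM`. -/
theorem gramM_apply (Ga : MKer 4 (Fin 4)) (y y' : Fin 4 → ℤ) (κ l : Fin 4) :
    gramM n Ga y y' κ l = contourSum n (kerOp₁ Ga (contourSumAdj n (unitSrc l y'))) κ y := rfl

/-- [our object] Unfolding `multM`. -/
theorem multM_apply (a' c : ℝ) (y' y₀ : Fin 4 → ℤ) (m l : Fin 4) :
    multM n a' c y' y₀ m l = c⁻¹ * (a' * (if y' = y₀ ∧ m = l then (1 : ℝ) else 0) + wΦ (N := n) m l (y' - y₀)) := rfl

/-- [folklore] **THE COARSE GRAM IS A DOUBLE FINITE LEG SUM**: `gramM n Ga y y′ κ l = Σ_{j} Σ_{i} Ga (legPt n κ y j) (legPt n l y′ i) κ l`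
over the `n⁵` contour legs of the two coarse bonds (`Tcol_eq`). -/
theorem gramM_eq_legSum (Ga : MKer 4 (Fin 4)) (y y' : Fin 4 → ℤ) (κ l : Fin 4) :
    gramM n Ga y y' κ l
      = ∑ j ∈ LegIdx 3 n, ∑ i ∈ LegIdx 3 n, Ga (legPt n (Sum.inl κ : Fib 3) y j) (legPt n (Sum.inl l : Fib 3) y' i) κ l :=
  Tcol_eq n Ga l y' κ y

/-- [folklore] The coarse Gram of a symmetric leg is symmetric (`Tcol_symm`). -/
theorem gramM_symm {Ga : MKer 4 (Fin 4)} (hGaSymm : ∀ x z κ m, Ga x z κ m = Ga z x m κ) (y y' : Fin 4 → ℤ) (κ l : Fin 4) :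
    gramM n Ga y y' κ l = gramM n Ga y' y l κ :=
  Tcol_symm n hGaSymm l y' κ y

omit [NeZero n] in
/-- [folklore] A contour leg of the translated coarse bond is the translated contour leg: `legPt n κ (y + v) j = legPt n κ y j + n•v`. -/
theorem legPt_inl_add (κ : Fin 4) (y v : Fin 4 → ℤ) (j : (Fin (3 + 1) → ℕ) × ℕ) :
    legPt n (Sum.inl κ : Fib 3) (y + v) j = legPt n (Sum.inl κ : Fib 3) y j + (n : ℤ) • v := by
  rw [legPt_inl_eq, legPt_inl_eq, smul_add]
  abel

/-- [folklore] **TRANSLATION INVARIANCE OF THE COARSE GRAM** under coarse unit shifts, from the block covariance of the leg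
(`shiftK (n•t) Ga = Ga`, e.g. `GluonLeg.shiftK_Ga`): `gramM n Ga (y + v) (y′ + v) κ l = gramM n Ga y y′ κ l`. -/
theorem gramM_translate {Ga : MKer 4 (Fin 4)} (hGa : ∀ t : Fin 4 → ℤ, shiftK ((n : ℤ) • t) Ga = Ga) (y y' v : Fin 4 → ℤ) (κ l : Fin 4) :
    gramM n Ga (y + v) (y' + v) κ l = gramM n Ga y y' κ l := by
  rw [gramM_eq_legSum, gramM_eq_legSum]
  refine Finset.sum_congr rfl fun j _ => Finset.sum_congr rfl fun i _ => ?_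
  rw [legPt_inl_add, legPt_inl_add]
  have h := congrFun (congrFun (congrFun (congrFun (hGa v) (legPt n (Sum.inl κ : Fib 3) y j)) (legPt n (Sum.inl l : Fib 3) y' i)) κ) l
  simpa only [shiftK] using h

/-- [folklore] Translation invariance of the shifted multiplier: `multM n a′ c (y′ + v) (y₀ + v) m l = multM n a′ c y′ y₀ m l`. -/
theorem multM_translate (a' c : ℝ) (y' y₀ v : Fin 4 → ℤ) (m l : Fin 4) :
    multM n a' c (y' + v) (y₀ + v) m l = multM n a' c y' y₀ m l := by
  simp only [multM, add_sub_add_right_eq_sub, add_left_inj]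

/-- [folklore] **AT THE ROAD'S CONSTANTS THE SHIFTED MULTIPLIER IS THE TYPED COARSE LEG UP TO `(m+1)⁸`**:
`multM (m+1) (2a/(m+1)⁸) 2 y′ y₀ m′ l = (m+1)⁻⁸ · Cun (m+1) a y′ y₀ m′ l` (`CoarseLegJunction.Cun_eq_wΦ`: `Cun = ((m+1)⁸/2)·wΦ + a·δ`). -/
theorem multM_road_eq_Cun (m : ℕ) (a : ℝ) (y' y₀ : Fin 4 → ℤ) (m' l : Fin 4) :
    multM (m + 1) (2 * a / ((m + 1 : ℕ) : ℝ) ^ 8) 2 y' y₀ m' l = (((m + 1 : ℕ) : ℝ) ^ 8)⁻¹ * Cun (m + 1) a y' y₀ m' l := by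
  rw [multM_apply, Cun_eq_wΦ]
  have hn : (((m + 1 : ℕ) : ℝ) ^ 8) ≠ 0 := pow_ne_zero _ (Nat.cast_ne_zero.2 (Nat.succ_ne_zero m))
  field_simp
  ring

/-! ## §2 X₁b in kernel form: the shifted multiplier is a right inverse of the coarse Gram on `ℤ⁴` -/

section Kernel

variable {Ga : MKer 4 (Fin 4)} {C δ : ℝ} {a r a' c : ℝ}

/-- [folklore] A uniform bound of the columns of the shifted multiplier (from `KernelSpecInstance.decay_wΦ`). -/
theorem exists_bound_multM_col (a' c : ℝ) (y₀ : Fin 4 → ℤ) (l₀ : Fin 4) :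
    ∃ M : ℝ, ∀ (m : Fin 4) (y' : Fin 4 → ℤ), |multM n a' c y' y₀ m l₀| ≤ M := by
  obtain ⟨δΦ, CΦ, hδΦ, hΦ⟩ := KernelSpecInstance.decay_wΦ (N := n) (d := 3)
  refine ⟨|c⁻¹| * (|a'| + CΦ), fun m y' => ?_⟩
  have hite : |a' * (if y' = y₀ ∧ m = l₀ then (1 : ℝ) else 0)| ≤ |a'| := by
    rw [abs_mul]; exact mul_le_of_le_one_right (abs_nonneg _) (by split_ifs <;> simp)
  have hw : |wΦ (N := n) m l₀ (y' - y₀)| ≤ CΦ := abs_le_of_decay510 hδΦ (hΦ m l₀) _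
  rw [multM_apply, abs_mul]
  exact mul_le_mul_of_nonneg_left ((abs_add_le _ _).trans (add_le_add hite hw)) (abs_nonneg _)

/-- [folklore] **X₁b IN KERNEL FORM** (right-inverse order): for a symmetric decaying fine leg `Ga` satisfying the X₁a display with constants
`(r, a′, c)`, `c ≠ 0`, the coarse Gram composed with the shifted multiplier is the identity kernel on the bonds of the unit lattice:
`compF (toF (gramM n Ga)) (toF (multM n a′ c)) = kdeltaF`, i.e. `Σ_l Σ'_{y′} (𝒬Ga𝒬ᵀ)((κ,y),(l,y′)) · Cun′((l,y′),(l₀,y₀)) = δ`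
(`T_apply_eq_tsum` + `T_apply_shiftedMultiplier`). -/
theorem compF_gramM_multM (ha : 0 < a) (hr : r ≠ 0) (hc : c ≠ 0) (hGa : Decays Ga C δ) (hδ : 0 < δ)
    (hX1a : ∀ (m : Fin 4) (z : Fin 4 → ℤ) (κ : Fin 4) (x : Fin 4 → ℤ),
      curvAdj (curv (fun κ' p => Ga p z κ' m)) κ x = c * delta1 m z κ x - r * dz (Rf n a (codiff₁ (fun κ' p => Ga p z κ' m))) κ x
        - a' * contourSumAdj n (contourSum n (fun κ' p => Ga p z κ' m)) κ x)
    (hGaSymm : ∀ x z κ m, Ga x z κ m = Ga z x m κ) :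
    compF (toF (gramM n Ga)) (toF (multM n a' c)) = kdeltaF := by
  classical
  funext i j
  obtain ⟨y, κ⟩ := i
  obtain ⟨y₀, l₀⟩ := j
  obtain ⟨M, hM⟩ := exists_bound_multM_col n a' c y₀ l₀
  -- the `(l₀, y₀)`-column of the shifted multiplier, as a coarse source
  set ω : Form1 4 ℝ := fun m y' => multM n a' c y' y₀ m l₀ with hω
  have hωb : ∀ m y', |ω m y'| ≤ M := fun m y' => hM m y'
  show (∑ l, ∑' y' : Fin 4 → ℤ, gramM n Ga y y' κ l * multM n a' c y' y₀ l l₀) = if (y, κ) = (y₀, l₀) then (1 : ℝ) else 0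
  have hsum : ∀ l ∈ (Finset.univ : Finset (Fin 4)), Summable fun y' : Fin 4 → ℤ => gramM n Ga y y' κ l * ω l y' :=
    fun l _ => summable_Tcol_mul n hGa hδ hωb κ l y
  have e1 : (∑ l, ∑' y' : Fin 4 → ℤ, gramM n Ga y y' κ l * multM n a' c y' y₀ l l₀)
      = ∑' y' : Fin 4 → ℤ, ∑ l, gramM n Ga y y' κ l * ω l y' := (Summable.tsum_finsetSum hsum).symm
  rw [e1]
  have e2 := T_apply_eq_tsum n hGa hδ hωb κ y
  simp only [← gramM_apply] at e2
  rw [← e2]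
  -- `ω = c⁻¹ • (a′δ + wΦ)`-column
  have hsrc : ω = c⁻¹ • (fun m y' => a' * (if y' = y₀ ∧ m = l₀ then (1 : ℝ) else 0) + wΦ (N := n) m l₀ (y' - y₀)) := by
    funext m y'
    simp only [hω, multM_apply, Pi.smul_apply, smul_eq_mul]
  rw [hsrc, contourSumAdj_smul, kerOp₁_smul, contourSum_smul, Pi.smul_apply, Pi.smul_apply, smul_eq_mul,
    T_apply_shiftedMultiplier n a ha hr hGa hδ hX1a hGaSymm l₀ y₀ κ y, inv_mul_cancel_left₀ hc]
  simp only [Prod.mk.injEq]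

end Kernel

/-! ## §3 The hypotheses of Lemma 2.2.2: summable rows, periodicity, uniform row bounds -/

section Hypotheses

variable {Ga : MKer 4 (Fin 4)} {C δ : ℝ}

/-- [folklore] The rows of the coarse Gram of a decaying leg are absolutely summable. -/
theorem summable_abs_row_gramM (hGa : Decays Ga C δ) (hδ : 0 < δ) (κ l : Fin 4) (y : Fin 4 → ℤ) :
    Summable fun y' : Fin 4 → ℤ => |gramM n Ga y y' κ l| := by
  have h := summable_Tcol_mul n hGa hδ (ω := fun _ _ => (1 : ℝ)) (Mω := 1) (fun _ _ => by rw [abs_one]) κ l y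
  simp only [mul_one] at h
  exact h.abs

/-- [folklore] The same, read on the fibres of `toF (gramM n Ga)`. -/
theorem summable_abs_Kfib_gramM (hGa : Decays Ga C δ) (hδ : 0 < δ) (κ l : Fin 4) (y : Fin 4 → ℤ) :
    Summable fun y' : Fin 4 → ℤ => |Kfib (toF (gramM n Ga)) κ l y y'| :=
  summable_abs_row_gramM n hGa hδ κ l y

/-- [folklore] The fibres of the coarse Gram of a block-covariant leg are translation invariant, hence jointly `p`-periodic for EVERY `p`. -/
theorem isPeriodic₂_gramM (hGac : ∀ t : Fin 4 → ℤ, shiftK ((n : ℤ) • t) Ga = Ga) (p : ℕ) (κ l : Fin 4) :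
    IsPeriodic₂ p (Kfib (toF (gramM n Ga)) κ l) :=
  IsPeriodic₂.of_transInv (fun y y' v => gramM_translate n hGac y y' v κ l) p

/-- [folklore] The fibres of the shifted multiplier are translation invariant, hence jointly `p`-periodic for every `p`. -/
theorem isPeriodic₂_multM (a' c : ℝ) (p : ℕ) (m l : Fin 4) : IsPeriodic₂ p (Kfib (toF (multM n a' c)) m l) :=
  IsPeriodic₂.of_transInv (fun y' y₀ v => multM_translate n a' c y' y₀ v m l) p

/-- [folklore] `multM n a′ c` decays (it IS the kernel of `spr_shiftedMultiplier`). -/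
theorem spr_multM (a' c : ℝ) : Spr (multM n a' c) :=
  spr_shiftedMultiplier n a' c

/-- [folklore] A UNIFORM ROW BOUND for the fibres of the shifted multiplier (from its decay). -/
theorem exists_rowBound_multM (a' c : ℝ) : ∃ B : ℝ, ∀ m l : Fin 4, RowBound (Kfib (toF (multM n a' c)) m l) B := by
  obtain ⟨C', δ', hδ', hdec⟩ := spr_multM n a' c
  refine ⟨C' * ∑' w : Fin 4 → ℤ, Real.exp (-δ' * l1 w), fun m l => ?_⟩
  have h2 : Decay₂ (Kfib (toF (multM n a' c)) m l) C' δ' := fun x y => hdec x y m l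
  exact h2.rowBound hδ'

/-- [folklore] A UNIFORM ROW BOUND for the fibres of the coarse Gram of a decaying block-covariant leg (translation invariance + summable rows,
an4's `IsPeriodic₂.rowBound_of_summable` at period `1`). -/
theorem exists_rowBound_gramM (hGa : Decays Ga C δ) (hδ : 0 < δ) (hGac : ∀ t : Fin 4 → ℤ, shiftK ((n : ℤ) • t) Ga = Ga) :
    ∃ B : ℝ, ∀ κ l : Fin 4, RowBound (Kfib (toF (gramM n Ga)) κ l) B := by
  classical
  -- fibrewise bounds at period 1, then the maximum over the sixteen fibres
  have hf : ∀ κ l : Fin 4, ∃ B : ℝ, RowBound (Kfib (toF (gramM n Ga)) κ l) B := fun κ l =>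
    ⟨_, (isPeriodic₂_gramM n hGac 1 κ l).rowBound_of_summable (summable_abs_Kfib_gramM n hGa hδ κ l)⟩
  choose B hB using hf
  refine ⟨∑ κ, ∑ l, |B κ l|, fun κ l x => ⟨(hB κ l x).1, (hB κ l x).2.trans ?_⟩⟩
  calc B κ l ≤ |B κ l| := le_abs_self _
    _ ≤ ∑ l', |B κ l'| := Finset.single_le_sum (f := fun l' => |B κ l'|) (fun _ _ => abs_nonneg _) (Finset.mem_univ l)
    _ ≤ ∑ κ', ∑ l', |B κ' l'| :=
        Finset.single_le_sum (f := fun κ' => ∑ l', |B κ' l'|) (fun _ _ => Finset.sum_nonneg fun _ _ => abs_nonneg _) (Finset.mem_univ κ)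

end Hypotheses

/-! ## §4 On every coarse torus: the periodised shifted multiplier inverts the periodised coarse Gram -/

section Torus

variable {Ga : MKer 4 (Fin 4)} {C δ : ℝ} {a r a' c : ℝ} (p : ℕ) [NeZero p]

/-- [folklore] **LEMMA 2.2.2 FOR THE COARSE GRAM**: on the coarse torus `Site 4 p`,
`(gramM n Ga)^ · (multM n a′ c)^ = 1` AND `(multM n a′ c)^ · (gramM n Ga)^ = 1` — the torus coarse Gram of the leg is invertible and its
inverse is the periodised shifted constraint multiplier (X₁b in kernel form + `FibredPeriodisation.lemma222F`). -/
theorem gram_torus_inverse (ha : 0 < a) (hr : r ≠ 0) (hc : c ≠ 0) (hGa : Decays Ga C δ) (hδ : 0 < δ)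
    (hX1a : ∀ (m : Fin 4) (z : Fin 4 → ℤ) (κ : Fin 4) (x : Fin 4 → ℤ),
      curvAdj (curv (fun κ' p => Ga p z κ' m)) κ x = c * delta1 m z κ x - r * dz (Rf n a (codiff₁ (fun κ' p => Ga p z κ' m))) κ x
        - a' * contourSumAdj n (contourSum n (fun κ' p => Ga p z κ' m)) κ x)
    (hGaSymm : ∀ x z κ m, Ga x z κ m = Ga z x m κ) :
    Matrix.of (periodiseF p (toF (gramM n Ga))) * Matrix.of (periodiseF p (toF (multM n a' c))) = 1
      ∧ Matrix.of (periodiseF p (toF (multM n a' c))) * Matrix.of (periodiseF p (toF (gramM n Ga))) = 1 := by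
  obtain ⟨B, hB⟩ := exists_rowBound_multM n a' c
  exact lemma222F (summable_abs_Kfib_gramM n hGa hδ) (isPeriodic₂_multM n a' c p) hB
    (compF_gramM_multM n ha hr hc hGa hδ hX1a hGaSymm)

/-- [folklore] Hence the torus coarse Gram has a unit determinant class (is invertible). -/
theorem isUnit_det_gram_torus (ha : 0 < a) (hr : r ≠ 0) (hc : c ≠ 0) (hGa : Decays Ga C δ) (hδ : 0 < δ)
    (hX1a : ∀ (m : Fin 4) (z : Fin 4 → ℤ) (κ : Fin 4) (x : Fin 4 → ℤ),
      curvAdj (curv (fun κ' p => Ga p z κ' m)) κ x = c * delta1 m z κ x - r * dz (Rf n a (codiff₁ (fun κ' p => Ga p z κ' m))) κ x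
        - a' * contourSumAdj n (contourSum n (fun κ' p => Ga p z κ' m)) κ x)
    (hGaSymm : ∀ x z κ m, Ga x z κ m = Ga z x m κ) :
    IsUnit (Matrix.of (periodiseF p (toF (gramM n Ga)))).det :=
  Matrix.isUnit_det_of_right_inverse (gram_torus_inverse n p ha hr hc hGa hδ hX1a hGaSymm).1

/-- [folklore] **THE INVERSE OF THE TORUS COARSE GRAM IS THE PERIODISED SHIFTED MULTIPLIER**: `((gramM n Ga)^)⁻¹ = (multM n a′ c)^`. -/
theorem gram_torus_inv_eq (ha : 0 < a) (hr : r ≠ 0) (hc : c ≠ 0) (hGa : Decays Ga C δ) (hδ : 0 < δ)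
    (hX1a : ∀ (m : Fin 4) (z : Fin 4 → ℤ) (κ : Fin 4) (x : Fin 4 → ℤ),
      curvAdj (curv (fun κ' p => Ga p z κ' m)) κ x = c * delta1 m z κ x - r * dz (Rf n a (codiff₁ (fun κ' p => Ga p z κ' m))) κ x
        - a' * contourSumAdj n (contourSum n (fun κ' p => Ga p z κ' m)) κ x)
    (hGaSymm : ∀ x z κ m, Ga x z κ m = Ga z x m κ) :
    (Matrix.of (periodiseF p (toF (gramM n Ga))))⁻¹ = Matrix.of (periodiseF p (toF (multM n a' c))) :=
  Matrix.inv_eq_right_inv (gram_torus_inverse n p ha hr hc hGa hδ hX1a hGaSymm).1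

/-- [folklore] **IDENTIFICATION OF A TORUS INVERSE**: ANY right inverse `X` of the torus coarse Gram IS the periodised shifted multiplier. -/
theorem eq_multM_hat_of_mul_eq_one (ha : 0 < a) (hr : r ≠ 0) (hc : c ≠ 0) (hGa : Decays Ga C δ) (hδ : 0 < δ)
    (hX1a : ∀ (m : Fin 4) (z : Fin 4 → ℤ) (κ : Fin 4) (x : Fin 4 → ℤ),
      curvAdj (curv (fun κ' p => Ga p z κ' m)) κ x = c * delta1 m z κ x - r * dz (Rf n a (codiff₁ (fun κ' p => Ga p z κ' m))) κ x
        - a' * contourSumAdj n (contourSum n (fun κ' p => Ga p z κ' m)) κ x)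
    (hGaSymm : ∀ x z κ m, Ga x z κ m = Ga z x m κ)
    {X : Matrix (Site 4 p × Fin 4) (Site 4 p × Fin 4) ℝ} (hX : Matrix.of (periodiseF p (toF (gramM n Ga))) * X = 1) :
    X = Matrix.of (periodiseF p (toF (multM n a' c))) := by
  obtain ⟨B, hB⟩ := exists_rowBound_multM n a' c
  exact eq_periodiseF_of_mul_eq_one (summable_abs_Kfib_gramM n hGa hδ) (isPeriodic₂_multM n a' c p) hB
    (compF_gramM_multM n ha hr hc hGa hδ hX1a hGaSymm) hX

/-- [folklore] The same for a left inverse. -/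
theorem eq_multM_hat_of_mul_eq_one' (ha : 0 < a) (hr : r ≠ 0) (hc : c ≠ 0) (hGa : Decays Ga C δ) (hδ : 0 < δ)
    (hX1a : ∀ (m : Fin 4) (z : Fin 4 → ℤ) (κ : Fin 4) (x : Fin 4 → ℤ),
      curvAdj (curv (fun κ' p => Ga p z κ' m)) κ x = c * delta1 m z κ x - r * dz (Rf n a (codiff₁ (fun κ' p => Ga p z κ' m))) κ x
        - a' * contourSumAdj n (contourSum n (fun κ' p => Ga p z κ' m)) κ x)
    (hGaSymm : ∀ x z κ m, Ga x z κ m = Ga z x m κ)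
    {X : Matrix (Site 4 p × Fin 4) (Site 4 p × Fin 4) ℝ} (hX : X * Matrix.of (periodiseF p (toF (gramM n Ga))) = 1) :
    X = Matrix.of (periodiseF p (toF (multM n a' c))) := by
  obtain ⟨B, hB⟩ := exists_rowBound_multM n a' c
  exact eq_periodiseF_of_mul_eq_one' (summable_abs_Kfib_gramM n hGa hδ) (isPeriodic₂_multM n a' c p) hB
    (compF_gramM_multM n ha hr hc hGa hδ hX1a hGaSymm) hX

end Torus

/-! ## §5 At the road's legs `Ga (m+1) a = K^∞`: the typed coarse leg `Cun (m+1) a` inverts the coarse Gram up to `(m+1)⁸` -/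

section RoadLegs

open Summit.QuantumFields.BalabanUV.Beta.D1BFx.LandauDictionaryInstance (hX1a_Ga)

variable (m : ℕ) {a : ℝ}

/-- [folklore] The fibres of the road's shifted multiplier are those of `(m+1)⁻⁸ · Cun (m+1) a`. -/
theorem toF_multM_road_eq (a : ℝ) :
    toF (multM (m + 1) (2 * a / ((m + 1 : ℕ) : ℝ) ^ 8) 2)
      = fun i j => (((m + 1 : ℕ) : ℝ) ^ 8)⁻¹ * toF (Cun (m + 1) a) i j := by
  funext i j
  exact multM_road_eq_Cun m a i.1 j.1 i.2 j.2

/-- [folklore] **X₁b IN KERNEL FORM AT THE ROAD'S LEGS**: `compF (toF (𝒬Ga𝒬ᵀ)) (toF (Cun (m+1) a)) = (m+1)⁸ • kdeltaF` for `Ga = Ga (m+1) a`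
— the typed coarse leg (typer object T3) IS `(m+1)⁸` times the inverse of the coarse Gram of the gluon leg on `ℤ⁴`, MODULO the displayed decay
`Spr (Ga (m+1) a)` (printed [B5, Prop. 1.2] ∧ [B5, (1.126)–(1.127)]); X₁a enters PROVED (`hX1a_Ga`), symmetry by `Ga_symm`. -/
theorem compF_gram_Cun_Ga (ha : 0 < a) (hGa : Spr (Ga (m + 1) a)) :
    compF (toF (gramM (m + 1) (Ga (m + 1) a))) (toF (Cun (m + 1) a))
      = fun i j => ((m + 1 : ℕ) : ℝ) ^ 8 * kdeltaF i j := by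
  classical
  obtain ⟨C, δ, hδ, hdec⟩ := hGa
  have hn : 1 ≤ m + 1 := Nat.le_add_left 1 m
  have hN : (((m + 1 : ℕ) : ℝ) ^ 8) ≠ 0 := pow_ne_zero _ (Nat.cast_ne_zero.2 (Nat.succ_ne_zero m))
  have h := compF_gramM_multM (m + 1) ha two_ne_zero two_ne_zero hdec hδ (hX1a_Ga m ha)
    (fun x z κ l => Ga_symm (m + 1) a hn ha x z κ l)
  funext i j
  have hij := congrFun (congrFun h i) j
  rw [toF_multM_road_eq] at hij
  -- `compF T ((m+1)⁻⁸ • S) = (m+1)⁻⁸ • compF T S`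
  have hlin : compF (toF (gramM (m + 1) (Ga (m + 1) a))) (fun i' j' => (((m + 1 : ℕ) : ℝ) ^ 8)⁻¹ * toF (Cun (m + 1) a) i' j') i j
      = (((m + 1 : ℕ) : ℝ) ^ 8)⁻¹ * compF (toF (gramM (m + 1) (Ga (m + 1) a))) (toF (Cun (m + 1) a)) i j := by
    simp only [compF, Finset.mul_sum, ← tsum_mul_left]
    refine Finset.sum_congr rfl fun b _ => tsum_congr fun y => ?_
    ring
  rw [hlin] at hij
  have := congrArg (fun t => ((m + 1 : ℕ) : ℝ) ^ 8 * t) hij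
  simpa only [mul_inv_cancel_left₀ hN] using this

variable (p : ℕ) [NeZero p]

/-- [folklore] **THE TORUS COARSE GRAM OF THE ROAD'S LEG AND ITS INVERSE**: on every coarse torus `Site 4 p`,
`(𝒬Ga𝒬ᵀ)^ · ((m+1)⁻⁸·Cun)^ = 1 ∧ ((m+1)⁻⁸·Cun)^ · (𝒬Ga𝒬ᵀ)^ = 1` for `Ga = Ga (m+1) a`, the inverse written as the periodised road multiplier
`multM (m+1) (2a/(m+1)⁸) 2` (= `(m+1)⁻⁸·Cun (m+1) a` fibrewise, `toF_multM_road_eq`); modulo `Spr (Ga (m+1) a)` only. -/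
theorem gram_torus_inverse_Ga (ha : 0 < a) (hGa : Spr (Ga (m + 1) a)) :
    Matrix.of (periodiseF p (toF (gramM (m + 1) (Ga (m + 1) a))))
        * Matrix.of (periodiseF p (toF (multM (m + 1) (2 * a / ((m + 1 : ℕ) : ℝ) ^ 8) 2))) = 1
      ∧ Matrix.of (periodiseF p (toF (multM (m + 1) (2 * a / ((m + 1 : ℕ) : ℝ) ^ 8) 2)))
        * Matrix.of (periodiseF p (toF (gramM (m + 1) (Ga (m + 1) a)))) = 1 := by
  obtain ⟨C, δ, hδ, hdec⟩ := hGa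
  have hn : 1 ≤ m + 1 := Nat.le_add_left 1 m
  exact gram_torus_inverse (m + 1) p ha two_ne_zero two_ne_zero hdec hδ (hX1a_Ga m ha)
    (fun x z κ l => Ga_symm (m + 1) a hn ha x z κ l)

/-- [folklore] The torus coarse Gram of the road's leg is invertible. -/
theorem isUnit_det_gram_torus_Ga (ha : 0 < a) (hGa : Spr (Ga (m + 1) a)) :
    IsUnit (Matrix.of (periodiseF p (toF (gramM (m + 1) (Ga (m + 1) a))))).det :=
  Matrix.isUnit_det_of_right_inverse (gram_torus_inverse_Ga m p ha hGa).1

/-- [folklore] **`((𝒬Ga𝒬ᵀ)^)⁻¹ = ((m+1)⁻⁸·Cun (m+1) a)^`** on every coarse torus (road's legs, modulo `Spr (Ga (m+1) a)`). -/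
theorem gram_torus_inv_eq_Ga (ha : 0 < a) (hGa : Spr (Ga (m + 1) a)) :
    (Matrix.of (periodiseF p (toF (gramM (m + 1) (Ga (m + 1) a)))))⁻¹
      = Matrix.of (periodiseF p (fun i j => (((m + 1 : ℕ) : ℝ) ^ 8)⁻¹ * toF (Cun (m + 1) a) i j)) := by
  rw [← toF_multM_road_eq]
  exact Matrix.inv_eq_right_inv (gram_torus_inverse_Ga m p ha hGa).1

omit [NeZero p] in
/-- [folklore] The fibres of the coarse Gram of the road's leg are jointly `p`-periodic for every `p` (`GluonLeg.shiftK_Ga`). -/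
theorem isPeriodic₂_gramM_Ga (a : ℝ) (κ l : Fin 4) : IsPeriodic₂ p (Kfib (toF (gramM (m + 1) (Ga (m + 1) a))) κ l) :=
  isPeriodic₂_gramM (m + 1) (fun t => shiftK_Ga (m + 1) a (Nat.le_add_left 1 m) t) p κ l

/-- [folklore] A uniform row bound for the fibres of the coarse Gram of the road's leg (modulo `Spr (Ga (m+1) a)`). -/
theorem exists_rowBound_gramM_Ga (hGa : Spr (Ga (m + 1) a)) :
    ∃ B : ℝ, ∀ κ l : Fin 4, RowBound (Kfib (toF (gramM (m + 1) (Ga (m + 1) a))) κ l) B := by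
  obtain ⟨C, δ, hδ, hdec⟩ := hGa
  exact exists_rowBound_gramM (m + 1) hdec hδ (fun t => shiftK_Ga (m + 1) a (Nat.le_add_left 1 m) t)

end RoadLegs

end Summit.QuantumFields.BalabanUV.Beta.D1BFx.CoarseGramInverse

end
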